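import Mathlib

/-!
# PercRepro — Lemma J: the level-wise rank level-set inequality is closed under coloops, and loops double it (typer-2, gen 6)

mine-2's LEMMA J (`proofs/MINE2-RLS.md` §10): if `e` is a coloop of `M` and `M' = M ＼ {e}` satisfies the
level-wise form (R1) of the rank level-set inequality for the pairs `(p − 1, q)` and `(p, q − 1)`, then `M`
satisfies it for `(p, q)`. With `n = p + q` the level-wise form reads
`C(n, u) · #U(p, q) ≤ C(n, p) · W_u` for every level `u`, where `W_u = #{S ⊆ E : r(S) = u}` and
`U(p, q) = {A ⊆ E : r(A) = p ∧ r(E ∖ A) = q}` (the spelling of p3's `c025_levelwise_of_rank_eq`).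

* **`levelCount_eq_of_isColoop`** — `W_u(M) = W_u(M') + W_{u−1}(M')` (`u ≥ 1`; `W_0(M) = W_0(M')`):
  a set either misses `e` (then its rank is its rank in `M'`) or is `insert e T` with `r(insert e T) = r(T) + 1`
  (`eRk_insert_eq_add_one`, a coloop is never in the closure of a set missing it);
* **`topCount_eq_of_isColoop`** — `#U_M(p, q) = #U_{M'}(p − 1, q) + #U_{M'}(p, q − 1)` (`p, q ≥ 1`; for `q = 0`
  only the first summand: `E ∖ A ∋ e` has rank `≥ 1`);
* **`levelwise_of_isColoop`** — LEMMA J: the four instances of the hypotheses (levels `u`, `u − 1`, both pairs)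
  SUM to the conclusion, by Pascal on both binomials (`C(n, u) = C(n−1, u) + C(n−1, u−1)`,
  `C(n, p) = C(n−1, p) + C(n−1, p−1)`) — no rational weights needed;
* **`levelCount_eq_of_isLoop`**, **`topCount_eq_of_isLoop`**, **`levelwise_iff_of_isLoop`** — a loop DOUBLES both counts
  (`insert e` is a bijection between the sets missing `e` and those containing it, ranks unchanged), so the
  level-wise form for `M` is the one for `M ＼ {e}` (mine-2's «loops halve»).
-/

namespace PercRepro

open Set
open scoped Matroid

namespace Matroid

variable {α : Type*} {M : _root_.Matroid α}

/-- `W_u(M)`: the number of subsets of the ground set of rank `u`. -/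
noncomputable def levelCount (M : _root_.Matroid α) (u : ℕ) : ℕ :=
  {S : Set α | S ⊆ M.E ∧ M.eRk S = (u : ℕ∞)}.ncard

/-- `#U(p, q)`: the number of `A ⊆ E` with `r(A) = p` and `r(E ∖ A) = q`. -/
noncomputable def topCount (M : _root_.Matroid α) (p q : ℕ) : ℕ :=
  {A : Set α | A ⊆ M.E ∧ M.eRk A = (p : ℕ∞) ∧ M.eRk (M.E \ A) = (q : ℕ∞)}.ncard

/-- The level-wise form (R1) for the pair `(p, q)`: `C(p+q, u) · #U(p, q) ≤ C(p+q, p) · W_u` at every level. -/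
def Levelwise (M : _root_.Matroid α) (p q : ℕ) : Prop :=
  ∀ u : ℕ, (p + q).choose u * topCount M p q ≤ (p + q).choose p * levelCount M u

section Coloop

variable {e : α} (he : M.IsColoop e)
include he

omit he in
/-- The rank in `M ＼ {e}` of a set missing `e` is its rank in `M`. -/
theorem eRk_delete_of_notMem {T : Set α} (hT : T ⊆ M.E) (heT : e ∉ T) :
    (M ＼ {e}).eRk T = M.eRk T := by
  rw [_root_.Matroid.delete_eq_restrict, _root_.Matroid.restrict_eRk_eq]
  intro x hx
  exact ⟨hT hx, fun h => heT (h ▸ hx)⟩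

omit he in
/-- The ground set of `M ＼ {e}`. -/
theorem delete_singleton_ground : (M ＼ {e}).E = M.E \ {e} := rfl

/-- Adding the coloop `e` to a set missing it raises the rank by one. -/
theorem eRk_insert_coloop {T : Set α} (heT : e ∉ T) : M.eRk (insert e T) = M.eRk T + 1 :=
  _root_.Matroid.eRk_insert_eq_add_one ⟨he.mem_ground, he.notMem_closure_of_notMem heT⟩

variable [M.Finite]

omit he [M.Finite] in
/-- The subsets of `M.E` of rank `u` that miss `e` are the subsets of `M ＼ {e}` of rank `u`. -/
theorem level_notMem_eq (u : ℕ) :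
    {S : Set α | S ⊆ M.E ∧ M.eRk S = (u : ℕ∞) ∧ e ∉ S} =
      {S : Set α | S ⊆ (M ＼ {e}).E ∧ (M ＼ {e}).eRk S = (u : ℕ∞)} := by
  ext S
  simp only [Set.mem_setOf_eq, delete_singleton_ground]
  constructor
  · rintro ⟨hS, hr, heS⟩
    refine ⟨fun x hx => ⟨hS hx, fun h => heS (h ▸ hx)⟩, ?_⟩
    rw [eRk_delete_of_notMem hS heS, hr]
  · rintro ⟨hS, hr⟩
    have hS' : S ⊆ M.E := fun x hx => (hS hx).1
    have heS : e ∉ S := fun h => (hS h).2 rfl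
    refine ⟨hS', ?_, heS⟩
    rw [← eRk_delete_of_notMem hS' heS, hr]

omit [M.Finite] in
/-- The subsets of `M.E` of rank `u + 1` containing `e` are `insert e T` for the subsets `T` of `M ＼ {e}` of
rank `u`. -/
theorem level_mem_eq (u : ℕ) :
    {S : Set α | S ⊆ M.E ∧ M.eRk S = ((u + 1 : ℕ) : ℕ∞) ∧ e ∈ S} =
      (fun T => insert e T) '' {T : Set α | T ⊆ (M ＼ {e}).E ∧ (M ＼ {e}).eRk T = (u : ℕ∞)} := by
  ext S
  simp only [Set.mem_setOf_eq, Set.mem_image, delete_singleton_ground]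
  constructor
  · rintro ⟨hS, hr, heS⟩
    refine ⟨S \ {e}, ⟨fun x hx => ⟨hS hx.1, hx.2⟩, ?_⟩, ?_⟩
    · have hT : S \ {e} ⊆ M.E := fun x hx => hS hx.1
      have heT : e ∉ S \ {e} := fun h => h.2 rfl
      rw [eRk_delete_of_notMem hT heT]
      have h1 := eRk_insert_coloop he heT
      rw [Set.insert_sdiff_singleton, Set.insert_eq_of_mem heS, hr] at h1
      push_cast at h1
      exact (ENat.add_left_injective_of_ne_top (by simp) h1).symm
    · rw [Set.insert_sdiff_singleton, Set.insert_eq_of_mem heS]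
  · rintro ⟨T, ⟨hT, hr⟩, rfl⟩
    have hT' : T ⊆ M.E := fun x hx => (hT hx).1
    have heT : e ∉ T := fun h => (hT h).2 rfl
    refine ⟨Set.insert_subset he.mem_ground hT', ?_, Set.mem_insert _ _⟩
    rw [eRk_insert_coloop he heT, ← eRk_delete_of_notMem hT' heT, hr]
    push_cast
    rfl

/-- **`W_{u+1}(M) = W_{u+1}(M ＼ {e}) + W_u(M ＼ {e})`** for a coloop `e`. -/
theorem levelCount_succ_eq_of_isColoop (u : ℕ) :
    levelCount M (u + 1) = levelCount (M ＼ {e}) (u + 1) + levelCount (M ＼ {e}) u := by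
  classical
  unfold levelCount
  have hfin : {S : Set α | S ⊆ M.E ∧ M.eRk S = ((u + 1 : ℕ) : ℕ∞)}.Finite :=
    M.ground_finite.finite_subsets.subset fun S hS => hS.1
  have hsplit : {S : Set α | S ⊆ M.E ∧ M.eRk S = ((u + 1 : ℕ) : ℕ∞)} =
      {S : Set α | S ⊆ M.E ∧ M.eRk S = ((u + 1 : ℕ) : ℕ∞) ∧ e ∉ S} ∪
        {S : Set α | S ⊆ M.E ∧ M.eRk S = ((u + 1 : ℕ) : ℕ∞) ∧ e ∈ S} := by
    ext S
    simp only [Set.mem_setOf_eq, Set.mem_union]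
    constructor
    · rintro ⟨h1, h2⟩
      by_cases h : e ∈ S
      · exact Or.inr ⟨h1, h2, h⟩
      · exact Or.inl ⟨h1, h2, h⟩
    · rintro (⟨h1, h2, _⟩ | ⟨h1, h2, _⟩) <;> exact ⟨h1, h2⟩
  have hdisj : Disjoint {S : Set α | S ⊆ M.E ∧ M.eRk S = ((u + 1 : ℕ) : ℕ∞) ∧ e ∉ S}
      {S : Set α | S ⊆ M.E ∧ M.eRk S = ((u + 1 : ℕ) : ℕ∞) ∧ e ∈ S} := by
    rw [Set.disjoint_left]
    rintro S ⟨_, _, h⟩ ⟨_, _, h'⟩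
    exact h h'
  have hinj : Set.InjOn (fun T : Set α => insert e T)
      {T : Set α | T ⊆ (M ＼ {e}).E ∧ (M ＼ {e}).eRk T = (u : ℕ∞)} := by
    intro T hT T' hT' h
    have heT : e ∉ T := fun h' => (hT.1 h').2 rfl
    have heT' : e ∉ T' := fun h' => (hT'.1 h').2 rfl
    rw [← Set.insert_sdiff_self_of_notMem heT, ← Set.insert_sdiff_self_of_notMem heT']
    exact congrArg (· \ {e}) h
  rw [hsplit, Set.ncard_union_eq hdisj (hfin.subset (hsplit ▸ Set.subset_union_left))
      (hfin.subset (hsplit ▸ Set.subset_union_right)),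
    level_notMem_eq, level_mem_eq he, hinj.ncard_image]

omit [M.Finite] in
/-- **`W_0(M) = W_0(M ＼ {e})`** for a coloop `e` (a set containing `e` has rank `≥ 1`). -/
theorem levelCount_zero_eq_of_isColoop : levelCount M 0 = levelCount (M ＼ {e}) 0 := by
  unfold levelCount
  rw [← level_notMem_eq]
  congr 1
  ext S
  simp only [Set.mem_setOf_eq]
  constructor
  · rintro ⟨hS, hr⟩
    refine ⟨hS, hr, fun heS => ?_⟩
    have h := eRk_insert_coloop he (T := S \ {e}) (fun h => h.2 rfl)
    rw [Set.insert_sdiff_singleton, Set.insert_eq_of_mem heS, hr] at h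
    have : (1 : ℕ∞) ≤ 0 := by
      calc (1 : ℕ∞) ≤ M.eRk (S \ {e}) + 1 := le_add_self
        _ = 0 := h.symm
    exact absurd this (by decide)
  · rintro ⟨hS, hr, _⟩
    exact ⟨hS, hr⟩

omit [M.Finite] in
/-- The members of `U_M(p + 1, q)` containing `e` are `insert e A` for `A ∈ U_{M ＼ {e}}(p, q)`. -/
theorem top_mem_eq (p q : ℕ) :
    {A : Set α | A ⊆ M.E ∧ M.eRk A = ((p + 1 : ℕ) : ℕ∞) ∧ M.eRk (M.E \ A) = (q : ℕ∞) ∧ e ∈ A} =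
      (fun T => insert e T) ''
        {A : Set α | A ⊆ (M ＼ {e}).E ∧ (M ＼ {e}).eRk A = (p : ℕ∞) ∧
          (M ＼ {e}).eRk ((M ＼ {e}).E \ A) = (q : ℕ∞)} := by
  ext S
  simp only [Set.mem_setOf_eq, Set.mem_image, delete_singleton_ground]
  constructor
  · rintro ⟨hS, hr, hr', heS⟩
    have hT : S \ {e} ⊆ M.E := fun x hx => hS hx.1
    have heT : e ∉ S \ {e} := fun h => h.2 rfl
    refine ⟨S \ {e}, ⟨fun x hx => ⟨hS hx.1, hx.2⟩, ?_, ?_⟩, ?_⟩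
    · rw [eRk_delete_of_notMem hT heT]
      have h1 := eRk_insert_coloop he heT
      rw [Set.insert_sdiff_singleton, Set.insert_eq_of_mem heS, hr] at h1
      push_cast at h1
      exact (ENat.add_left_injective_of_ne_top (by simp) h1).symm
    · have hc : (M.E \ {e}) \ (S \ {e}) = M.E \ S := by
        ext x
        simp only [Set.mem_sdiff, Set.mem_singleton_iff, not_and, not_not]
        constructor
        · rintro ⟨⟨hxE, hxe⟩, h⟩
          exact ⟨hxE, fun hxS => hxe (h hxS)⟩
        · rintro ⟨hxE, hxS⟩
          exact ⟨⟨hxE, fun hxe => hxS (hxe ▸ heS)⟩, fun hxS' => absurd hxS' hxS⟩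
      rw [hc, eRk_delete_of_notMem Set.sdiff_subset (fun h => h.2 heS), hr']
    · rw [Set.insert_sdiff_singleton, Set.insert_eq_of_mem heS]
  · rintro ⟨T, ⟨hT, hr, hr'⟩, rfl⟩
    have hT' : T ⊆ M.E := fun x hx => (hT hx).1
    have heT : e ∉ T := fun h => (hT h).2 rfl
    refine ⟨Set.insert_subset he.mem_ground hT', ?_, ?_, Set.mem_insert _ _⟩
    · rw [eRk_insert_coloop he heT, ← eRk_delete_of_notMem hT' heT, hr]
      push_cast
      rfl
    · have hc : M.E \ insert e T = (M.E \ {e}) \ T := by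
        ext x
        simp only [Set.mem_sdiff, Set.mem_insert_iff, Set.mem_singleton_iff, not_or]
        tauto
      rw [hc, ← hr', eRk_delete_of_notMem (fun x hx => hx.1.1) (fun h => h.1.2 rfl)]

omit [M.Finite] in
/-- The members of `U_M(p, q + 1)` missing `e` are the members of `U_{M ＼ {e}}(p, q)`. -/
theorem top_notMem_eq (p q : ℕ) :
    {A : Set α | A ⊆ M.E ∧ M.eRk A = (p : ℕ∞) ∧ M.eRk (M.E \ A) = ((q + 1 : ℕ) : ℕ∞) ∧ e ∉ A} =
      {A : Set α | A ⊆ (M ＼ {e}).E ∧ (M ＼ {e}).eRk A = (p : ℕ∞) ∧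
        (M ＼ {e}).eRk ((M ＼ {e}).E \ A) = (q : ℕ∞)} := by
  ext A
  simp only [Set.mem_setOf_eq, delete_singleton_ground]
  constructor
  · rintro ⟨hA, hr, hr', heA⟩
    refine ⟨fun x hx => ⟨hA hx, fun h => heA (h ▸ hx)⟩, ?_, ?_⟩
    · rw [eRk_delete_of_notMem hA heA, hr]
    · have hc : M.E \ A = insert e ((M.E \ {e}) \ A) := by
        ext x
        simp only [Set.mem_sdiff, Set.mem_insert_iff, Set.mem_singleton_iff]
        constructor
        · rintro ⟨hxE, hxA⟩
          by_cases hx : x = e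
          · exact Or.inl hx
          · exact Or.inr ⟨⟨hxE, hx⟩, hxA⟩
        · rintro (rfl | ⟨⟨hxE, _⟩, hxA⟩)
          · exact ⟨he.mem_ground, heA⟩
          · exact ⟨hxE, hxA⟩
      have heT : e ∉ (M.E \ {e}) \ A := fun h => h.1.2 rfl
      rw [hc, eRk_insert_coloop he heT] at hr'
      rw [eRk_delete_of_notMem (fun x hx => hx.1.1) heT]
      push_cast at hr'
      exact ENat.add_left_injective_of_ne_top (by simp) hr'
  · rintro ⟨hA, hr, hr'⟩
    have hA' : A ⊆ M.E := fun x hx => (hA hx).1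
    have heA : e ∉ A := fun h => (hA h).2 rfl
    refine ⟨hA', ?_, ?_, heA⟩
    · rw [← eRk_delete_of_notMem hA' heA, hr]
    · have hc : M.E \ A = insert e ((M.E \ {e}) \ A) := by
        ext x
        simp only [Set.mem_sdiff, Set.mem_insert_iff, Set.mem_singleton_iff]
        constructor
        · rintro ⟨hxE, hxA⟩
          by_cases hx : x = e
          · exact Or.inl hx
          · exact Or.inr ⟨⟨hxE, hx⟩, hxA⟩
        · rintro (rfl | ⟨⟨hxE, _⟩, hxA⟩)
          · exact ⟨he.mem_ground, heA⟩
          · exact ⟨hxE, hxA⟩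
      have heT : e ∉ (M.E \ {e}) \ A := fun h => h.1.2 rfl
      rw [hc, eRk_insert_coloop he heT, ← eRk_delete_of_notMem (fun x hx => hx.1.1) heT, hr']
      push_cast
      rfl

omit [M.Finite] in
/-- Members of `U_M(p, 0)` contain `e` (`E ∖ A ∋ e` would have rank `≥ 1`). -/
theorem mem_of_top_zero {A : Set α} (hr' : M.eRk (M.E \ A) = 0) : e ∈ A := by
  by_contra heA
  have hc : M.E \ A = insert e ((M.E \ {e}) \ A) := by
    ext x
    simp only [Set.mem_sdiff, Set.mem_insert_iff, Set.mem_singleton_iff]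
    constructor
    · rintro ⟨hxE, hxA⟩
      by_cases hx : x = e
      · exact Or.inl hx
      · exact Or.inr ⟨⟨hxE, hx⟩, hxA⟩
    · rintro (rfl | ⟨⟨hxE, _⟩, hxA⟩)
      · exact ⟨he.mem_ground, heA⟩
      · exact ⟨hxE, hxA⟩
  have heT : e ∉ (M.E \ {e}) \ A := fun h => h.1.2 rfl
  rw [hc, eRk_insert_coloop he heT] at hr'
  have : (1 : ℕ∞) ≤ 0 := by
    calc (1 : ℕ∞) ≤ M.eRk ((M.E \ {e}) \ A) + 1 := le_add_self
      _ = 0 := hr'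
  exact absurd this (by decide)

/-- **`#U_M(p + 1, q + 1) = #U_{M'}(p, q + 1) + #U_{M'}(p + 1, q)`** for a coloop `e`, `M' = M ＼ {e}`. -/
theorem topCount_succ_succ_eq_of_isColoop (p q : ℕ) :
    topCount M (p + 1) (q + 1) = topCount (M ＼ {e}) p (q + 1) + topCount (M ＼ {e}) (p + 1) q := by
  classical
  unfold topCount
  set P : ℕ∞ := ((p + 1 : ℕ) : ℕ∞) with hP
  set Q : ℕ∞ := ((q + 1 : ℕ) : ℕ∞) with hQ
  have hfin : {A : Set α | A ⊆ M.E ∧ M.eRk A = P ∧ M.eRk (M.E \ A) = Q}.Finite :=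
    M.ground_finite.finite_subsets.subset fun A hA => hA.1
  have hsplit : {A : Set α | A ⊆ M.E ∧ M.eRk A = P ∧ M.eRk (M.E \ A) = Q} =
      {A : Set α | A ⊆ M.E ∧ M.eRk A = P ∧ M.eRk (M.E \ A) = Q ∧ e ∈ A} ∪
        {A : Set α | A ⊆ M.E ∧ M.eRk A = P ∧ M.eRk (M.E \ A) = Q ∧ e ∉ A} := by
    ext A
    simp only [Set.mem_setOf_eq, Set.mem_union]
    constructor
    · rintro ⟨h1, h2, h3⟩
      by_cases h : e ∈ A
      · exact Or.inl ⟨h1, h2, h3, h⟩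
      · exact Or.inr ⟨h1, h2, h3, h⟩
    · rintro (⟨h1, h2, h3, _⟩ | ⟨h1, h2, h3, _⟩) <;> exact ⟨h1, h2, h3⟩
  have hdisj : Disjoint {A : Set α | A ⊆ M.E ∧ M.eRk A = P ∧ M.eRk (M.E \ A) = Q ∧ e ∈ A}
      {A : Set α | A ⊆ M.E ∧ M.eRk A = P ∧ M.eRk (M.E \ A) = Q ∧ e ∉ A} := by
    rw [Set.disjoint_left]
    rintro A ⟨_, _, _, h⟩ ⟨_, _, _, h'⟩
    exact h' h
  have hinj : Set.InjOn (fun T : Set α => insert e T)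
      {A : Set α | A ⊆ (M ＼ {e}).E ∧ (M ＼ {e}).eRk A = (p : ℕ∞) ∧
        (M ＼ {e}).eRk ((M ＼ {e}).E \ A) = ((q + 1 : ℕ) : ℕ∞)} := by
    intro T hT T' hT' h
    have heT : e ∉ T := fun h' => (hT.1 h').2 rfl
    have heT' : e ∉ T' := fun h' => (hT'.1 h').2 rfl
    rw [← Set.insert_sdiff_self_of_notMem heT, ← Set.insert_sdiff_self_of_notMem heT']
    exact congrArg (· \ {e}) h
  rw [hsplit, Set.ncard_union_eq hdisj (hfin.subset (hsplit ▸ Set.subset_union_left))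
      (hfin.subset (hsplit ▸ Set.subset_union_right)),
    hP, hQ, top_mem_eq he, top_notMem_eq he, hinj.ncard_image]

omit [M.Finite] in
/-- **`#U_M(p + 1, 0) = #U_{M'}(p, 0)`** for a coloop `e`. -/
theorem topCount_succ_zero_eq_of_isColoop (p : ℕ) :
    topCount M (p + 1) 0 = topCount (M ＼ {e}) p 0 := by
  classical
  unfold topCount
  simp only [Nat.cast_zero]
  have hall : {A : Set α | A ⊆ M.E ∧ M.eRk A = ((p + 1 : ℕ) : ℕ∞) ∧ M.eRk (M.E \ A) = 0} =
      {A : Set α | A ⊆ M.E ∧ M.eRk A = ((p + 1 : ℕ) : ℕ∞) ∧ M.eRk (M.E \ A) = 0 ∧ e ∈ A} := by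
    ext A
    simp only [Set.mem_setOf_eq]
    constructor
    · rintro ⟨h1, h2, h3⟩
      exact ⟨h1, h2, h3, mem_of_top_zero he h3⟩
    · rintro ⟨h1, h2, h3, _⟩
      exact ⟨h1, h2, h3⟩
  have hinj : Set.InjOn (fun T : Set α => insert e T)
      {A : Set α | A ⊆ (M ＼ {e}).E ∧ (M ＼ {e}).eRk A = (p : ℕ∞) ∧
        (M ＼ {e}).eRk ((M ＼ {e}).E \ A) = 0} := by
    intro T hT T' hT' h
    have heT : e ∉ T := fun h' => (hT.1 h').2 rfl
    have heT' : e ∉ T' := fun h' => (hT'.1 h').2 rfl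
    rw [← Set.insert_sdiff_self_of_notMem heT, ← Set.insert_sdiff_self_of_notMem heT']
    exact congrArg (· \ {e}) h
  have h := top_mem_eq he p 0
  simp only [Nat.cast_zero] at h
  rw [hall, h, hinj.ncard_image]

/-- **Lemma J** (mine-2 §10): if `e` is a coloop and `M ＼ {e}` satisfies the level-wise form for `(p, q + 1)`
and `(p + 1, q)`, then `M` satisfies it for `(p + 1, q + 1)` — the four hypotheses at the levels `u` and `u − 1`
sum to the conclusion by Pascal. -/
theorem levelwise_of_isColoop (p q : ℕ) (h1 : Levelwise (M ＼ {e}) p (q + 1))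
    (h2 : Levelwise (M ＼ {e}) (p + 1) q) : Levelwise M (p + 1) (q + 1) := by
  intro u
  rw [topCount_succ_succ_eq_of_isColoop he]
  have hn : p + 1 + (q + 1) = (p + (q + 1)) + 1 := by ring
  have hn' : p + 1 + q = p + (q + 1) := by ring
  rcases u with _ | u
  · -- level `0`
    rw [levelCount_zero_eq_of_isColoop he, Nat.choose_zero_right, hn, Nat.choose_succ_succ]
    have a1 := h1 0
    have a2 := h2 0
    rw [Nat.choose_zero_right] at a1 a2
    rw [hn'] at a2
    nlinarith [a1, a2]
  · rw [levelCount_succ_eq_of_isColoop he, hn, Nat.choose_succ_succ, Nat.choose_succ_succ]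
    have a1 := h1 (u + 1)
    have a1' := h1 u
    have a2 := h2 (u + 1)
    have a2' := h2 u
    rw [hn'] at a2 a2'
    nlinarith [a1, a1', a2, a2']

/-- **Lemma J at `q = 0`**: if `M ＼ {e}` satisfies the level-wise form for `(p, 0)`, so does `M` for
`(p + 1, 0)`. -/
theorem levelwise_zero_of_isColoop (p : ℕ) (h1 : Levelwise (M ＼ {e}) p 0) :
    Levelwise M (p + 1) 0 := by
  intro u
  rw [topCount_succ_zero_eq_of_isColoop he]
  rcases u with _ | u
  · rw [levelCount_zero_eq_of_isColoop he, Nat.choose_zero_right, Nat.choose_self]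
    have a1 := h1 0
    rw [Nat.choose_zero_right, Nat.add_zero, Nat.choose_self] at a1
    simpa using a1
  · rw [levelCount_succ_eq_of_isColoop he, Nat.add_zero, Nat.choose_succ_succ, Nat.choose_self]
    have a1 := h1 (u + 1)
    have a1' := h1 u
    rw [Nat.add_zero, Nat.choose_self] at a1 a1'
    nlinarith [a1, a1']

end Coloop

end Matroid

end PercRepro
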